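import Summits.CriticalPhenomena.SAWScalingLimit.Theses.SAWReversalUpgrade
import Summits.CriticalPhenomena.SAWScalingLimit.Theorems.SAWDevelopingMapHexTransferNoReturnToStart
import Summits.CriticalPhenomena.SAWScalingLimit.Theorems.SubseqIdentification.Negative.ProbabilityRedundant
import HarnessLib

/-!
# `SAWReversalUpgrade.NoDeepReturn` (stmt-CriticalPhenomena-18004) is a NECESSARY condition of the
# conjunct `SAWScalingLimit`

Crux-strategist census artefact (seat `planner-cstrat-stmt-CriticalPhenomena-18004-b1-0`,
§Negation of `Cruxes/NoDeepReturn/STRATEGY-CENSUS.md`): the refuter's on-paper remark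
"S ⇒ C" (crux attack at birth, 2026-08-17T08:22Z) kernel-checked on `δℤ²`, as the square-lattice
twin of `hex_noReturnToStart_of_hexSAWScalingLimit`
(`Theorems/SAWDevelopingMapHexTransferNoReturnToStart.lean`, whose curve-level lemmas
`isClosed_setOf_farNear`, `not_forall_farNear_of_isSimple`, `farNear_of_mk_eq_mk`,
`ae_source_eq_of_isSLELaw` are lattice-free and reused verbatim).

Consequence recorded in the census: a counterexample to the crux refutes the Lawler–Schramm–Werner
conjunct for the same `(D, a_δ, b_δ)`; the negation lens has no target short of the summit.

Proof: the event `F_{ε,r}` ("some representative is `ε`-far from `a` at a time and `r`-close at a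
later time") is closed in `CurveClass ℂ`; the SLE₈⸝₃ law charges `⋂ₙ F_{ε,1/(n+1)}` with mass `0`
(a.e. class is simple — Rohde–Schramm, `κ = 8/3 ≤ 4`, discharged in the tree — and starts at
`a = D.pt 0`, so a return to `a` after leaving `B(a, ε)` would be a double point); continuity from
above and the portmanteau theorem give `limsup_δ P_δ(F_{ε,r}) ≤ η/2` for some `r`; the crux's event
(stated on the polyline representative with `s < t`) is contained in `F_{ε,r}`. [folklore]
-/

noncomputable section

namespace Summit.CriticalPhenomena.SAWScalingLimit.Cruxes.NoDeepReturn.Strategist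

open MeasureTheory Filter Topology Set Metric
open scoped NNReal ENNReal BoundedContinuousFunction
open Literature.Probability.RandomPlanarGeometry
open Literature.Probability.RandomPlanarGeometry.SAW
open Literature.Probability.LatticeModels (Site meshPoint)
open Literature.Probability (Process.preWienerMeasure)
open Summit.CriticalPhenomena.SAWScalingLimit.Cruxes.HexTransfer.YbRelay
  (isClosed_setOf_farNear not_forall_farNear_of_isSimple farNear_of_mk_eq_mk
    ae_source_eq_of_isSLELaw)

/-- **No deep return to the start is necessary for the scaling limit** (`δℤ²`): granted
`SAWScalingLimit`, for every Dobrushin domain, endpoint approximation, `R > 0` and `η > 0` there is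
`r > 0` such that for all small `δ` the critical SAW law gives mass `≤ η` to the walks whose drawn
curve has SOME representative at distance `≥ R` from `a = D.pt 0` at a time and within `r` of `a`
at a later (`≤`) time. [folklore] -/
theorem farNear_small_of_sawScalingLimit (hS : _root_.SAWScalingLimit) (D : DobrushinDomain)
    (a b : ℝ → Site 2) (hab : IsEndpointApprox D a b) (R : ℝ) (hR : 0 < R) (η : ℝ) (hη : 0 < η) :
    ∃ r : ℝ, 0 < r ∧ ∀ᶠ δ in 𝓝[>] (0 : ℝ), law D.carrier δ (a δ) (b δ)
      {γ | ∃ c : Curve ℂ, CurveClass.mk c = γ.curve ∧ ∃ t₁ t₂ : unitInterval, t₁ ≤ t₂ ∧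
        R ≤ dist (c t₁) (D.pt 0) ∧ dist (c t₂) (D.pt 0) ≤ r} ≤ ENNReal.ofReal η := by
  classical
  haveI := Literature.Probability.RandomPlanarGeometry.isProbabilityMeasure_preWienerMeasure'
  obtain ⟨Γ, hΓ, -, hT⟩ := hS D a b hab
  -- the closed events `E r`
  let E : ℝ → Set (CurveClass ℂ) := fun r => {c | ∃ γ : Curve ℂ, CurveClass.mk γ = c ∧
    ∃ t₁ t₂ : unitInterval, t₁ ≤ t₂ ∧ R ≤ dist (γ t₁) (D.pt 0) ∧ dist (γ t₂) (D.pt 0) ≤ r}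
  have hEcl : ∀ r, IsClosed (E r) := fun r => isClosed_setOf_farNear (D.pt 0) R r
  have hEmeas : ∀ r, MeasurableSet (E r) := fun r => (hEcl r).measurableSet
  have hEmono : Antitone fun n : ℕ => E (1 / ((n : ℝ) + 1)) := by
    intro m n hmn c hc
    obtain ⟨γ, hγ, t₁, t₂, ht, h1, h2⟩ := hc
    refine ⟨γ, hγ, t₁, t₂, ht, h1, h2.trans ?_⟩
    exact one_div_le_one_div_of_le (by positivity) (by exact_mod_cast Nat.succ_le_succ hmn)
  -- the SLE law does not charge the limiting event
  let μ : Measure (CurveClass ℂ) := Process.preWienerMeasure.map Γ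
  haveI hμ : IsProbabilityMeasure μ := Measure.isProbabilityMeasure_map hΓ.aemeasurable
  have hμ0 : μ (⋂ n : ℕ, E (1 / ((n : ℝ) + 1))) = 0 := by
    have hs := IsSLELaw.ae_simple ae_isSimpleTrace_sleTrace_of_le_four_holds
      CurveClass.measurableSet_simple_holds (by positivity)
      (by rw [div_le_iff₀ (by norm_num : (0 : ℝ≥0) < 3)]; norm_num) hΓ.isSLELaw_map
    have hsrc := ae_source_eq_of_isSLELaw hΓ.isSLELaw_map
    refine measure_mono_null (fun c hc => ?_) (ae_iff.1 (hs.and hsrc))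
    simp only [mem_setOf_eq]
    rintro ⟨⟨⟨γ₀, hγ₀, rfl⟩, -⟩, hsrc0⟩
    rw [mem_iInter] at hc
    rw [CurveClass.source_mk] at hsrc0
    refine not_forall_farNear_of_isSimple hγ₀ hsrc0 hR fun n => ?_
    obtain ⟨γ, hγ, hP⟩ := hc n
    exact farNear_of_mk_eq_mk hγ hP
  -- continuity from above: some `E (1/(N+1))` has SLE-mass `≤ η/2`
  have hμlim : Tendsto (fun n : ℕ => μ (E (1 / ((n : ℝ) + 1)))) atTop (𝓝 0) := by
    have h := tendsto_measure_iInter_atTop (μ := μ) (fun n => (hEmeas _).nullMeasurableSet) hEmono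
      ⟨0, measure_ne_top μ _⟩
    rwa [hμ0] at h
  obtain ⟨N, hN⟩ := (ENNReal.tendsto_atTop_zero.1 hμlim) (ENNReal.ofReal (η / 2))
    (ENNReal.ofReal_pos.2 (half_pos hη))
  have hNle : μ (E (1 / ((N : ℝ) + 1))) ≤ ENNReal.ofReal (η / 2) := hN N le_rfl
  refine ⟨1 / ((N : ℝ) + 1), by positivity, ?_⟩
  -- the critical SAW laws are eventually probability measures
  let Pδ : ∀ δ : ℝ, Measure (DomainSAW D.carrier δ (a δ) (b δ)) := fun δ =>
    law D.carrier δ (a δ) (b δ)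
  have hev : ∀ᶠ δ in 𝓝[>] (0 : ℝ), IsProbabilityMeasure (Pδ δ) :=
    Summit.CriticalPhenomena.SAWScalingLimit.Theorems.SubseqIdentification.Negative.eventually_isProbabilityMeasure_law
      hab
  let ν : ProbabilityMeasure (CurveClass ℂ) := ⟨μ, hμ⟩
  let νs : ℝ → ProbabilityMeasure (CurveClass ℂ) := fun δ =>
    if hδ : IsProbabilityMeasure (Pδ δ) then
      ⟨(Pδ δ).map (fun γ => γ.curve),
        Measure.isProbabilityMeasure_map (DomainSAW.measurable_of_top _).aemeasurable⟩
    else ν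
  have hT' : Tendsto νs (𝓝[>] 0) (𝓝 ν) := by
    rw [ProbabilityMeasure.tendsto_iff_forall_integral_tendsto]
    intro f
    have h1 := hT f
    have e2 : ∫ x, f x ∂(ν : Measure (CurveClass ℂ)) = ∫ ω, f (Γ ω) ∂Process.preWienerMeasure :=
      integral_map hΓ.aemeasurable f.continuous.aestronglyMeasurable
    rw [e2]
    refine h1.congr' ?_
    filter_upwards [hev] with δ hδ
    simp only [νs, dif_pos hδ, ProbabilityMeasure.coe_mk]
    exact (integral_map (DomainSAW.measurable_of_top _).aemeasurable
      f.continuous.aestronglyMeasurable).symm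
  have hlimsup := ProbabilityMeasure.limsup_measure_closed_le_of_tendsto hT' (hEcl (1 / ((N : ℝ) + 1)))
  have hlt : limsup (fun δ => (νs δ : Measure (CurveClass ℂ)) (E (1 / ((N : ℝ) + 1)))) (𝓝[>] 0) <
      ENNReal.ofReal η :=
    lt_of_le_of_lt (hlimsup.trans hNle) ((ENNReal.ofReal_lt_ofReal_iff hη).2 (by linarith))
  filter_upwards [hev, Filter.eventually_lt_of_limsup_lt hlt] with δ hδ h2
  have key : law D.carrier δ (a δ) (b δ) {γ | ∃ c : Curve ℂ, CurveClass.mk c = γ.curve ∧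
      ∃ t₁ t₂ : unitInterval, t₁ ≤ t₂ ∧ R ≤ dist (c t₁) (D.pt 0) ∧
        dist (c t₂) (D.pt 0) ≤ 1 / ((N : ℝ) + 1)} =
      (νs δ : Measure (CurveClass ℂ)) (E (1 / ((N : ℝ) + 1))) := by
    simp only [νs, dif_pos hδ, ProbabilityMeasure.coe_mk]
    rw [Measure.map_apply (DomainSAW.measurable_of_top _) (hEmeas _)]
    rfl
  rw [key]
  exact h2.le

/-- **`SAWScalingLimit → SAWReversalUpgrade.NoDeepReturn`**: the crux is a necessary condition of
the conjunct (its event, stated on the polyline representative with strict time order `s < t`, is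
contained in the closed "far then near" event of `farNear_small_of_sawScalingLimit`). [folklore] -/
theorem noDeepReturn_of_sawScalingLimit :
    _root_.SAWScalingLimit →
      Summit.CriticalPhenomena.SAWScalingLimit.Theses.SAWReversalUpgrade.NoDeepReturn := by
  intro hS D a b hab ε hε η hη
  obtain ⟨r, hr, hev⟩ := farNear_small_of_sawScalingLimit hS D a b hab ε hε η hη
  refine ⟨r, hr, ?_⟩
  filter_upwards [hev] with δ hδ
  refine le_trans (measure_mono ?_) hδ
  rintro γ ⟨s, t, hst, h1, h2⟩
  exact ⟨⟨γ.walk.toCurve (meshPoint δ)⟩, rfl, s, t, hst.le, h1, h2⟩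

/-- Contrapositive, the form used by the census: **refuting the crux refutes the conjunct.**
[folklore] -/
theorem not_sawScalingLimit_of_not_noDeepReturn
    (h : ¬ Summit.CriticalPhenomena.SAWScalingLimit.Theses.SAWReversalUpgrade.NoDeepReturn) :
    ¬ _root_.SAWScalingLimit :=
  fun hS => h (noDeepReturn_of_sawScalingLimit hS)

end Summit.CriticalPhenomena.SAWScalingLimit.Cruxes.NoDeepReturn.Strategist

end
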